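import Summits.BirchSwinnertonDyer.BirchSwinnertonDyer.Theorems.ByReductionTypeAtTwoRankOneAtTwoBigImageOddLocalOneDoorKolyvaginExactBridgeC
import Summits.BirchSwinnertonDyer.Rank1Residual.AdditivePotMult.ModelFreeClassTheorems
import HarnessLib

/-!
# Route ByReductionTypeAtTwo, crux `RankOneAtTwoBigImageOddLocal` (stmt-BirchSwinnertonDyer-23715), LINE v8.5 `one_door_analytic`:
# the HALVES over `K` — Kolyvagin's UPPER bound at `2` (c-corrected) gives the Euler-system half of `BSD₂(W)`, and dually

Width prover seat `bsd-line-fkl-p2` g8 (2026-08-28), `--supports stmt-BirchSwinnertonDyer-23715`.  THEOREMS ONLY; nothing is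
asserted; BSD is not proved by any of this.  K-side companion of `…OneDoorValuation.lean` / `…OneDoorHalves.lean` (E-side halves).

The width seat's g7 file `…OneDoorKolyvaginExactBridgeC.lean` (p624011) reads `BSD₂(W)` on the slice off ONE K-side binder, the
c-corrected `2`-part of Gross's Conjecture (2.2) over `K` at conductor `1`: `ord₂ #Ш(E_K)[2^∞] + 2·v₂(c) = 2·M₀` (`M₀` the exact
`2`-divisibility exponent of `y_K`).  That EQUALITY is two inequalities of very different standing:

* `≤` — **Kolyvagin's UPPER BOUND at `2`**: `ord₂ #Ш(E_K)[2^∞] ≤ 2·ord₂ [E(K):ℤy_K] − 2·v₂(c)`.  An Euler-system statement (Kolyvagin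
  1990, Thm. A / Gross 1991 Thm. 1.3 give it at `2` only up to a `2`-power error term; exact at odd `p` with `ρ̄_{E,p}` onto, McCallum
  1991 §1; at `p = 2` NOT in print, but strictly weaker than the exactness crux `KolyvaginExactAtTwo` of route GenusKolyvaginAtTwo);
* `≥` — the `2`-adic Gross–Zagier / main-conjecture direction.

This file transports each inequality SEPARATELY from `K` to `ℚ`, in Miller's one-sided currency
(`Typed.MissingUpperBoundAt W 2`: `ord₂ #Ш(W) ≤ ord₂ #Ш_an(W)`; `Typed.MissingLowerBoundAt W 2`: the reverse):

* §1 `missingUpperBoundAt_of_upperOverC_baseChange` / `missingLowerBoundAt_of_lowerOverC_baseChange` (any prime `p`): the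
  ONE-SIDED model-free quadratic descent on the canonical model — `AdditivePotMult.MissingUpperBoundOverCAt (W.baseChange K) p` and
  `BSD(Wd,p)` for a minimal twin give `MissingUpperBoundAt W p` (the `p`-adic BSD defect is invariant under the descent,
  `AdditivePotMult.missingUpperBoundAt_iff_overC`, with Milne 1972 any-model `hMilneC` supplying `Ш(E_K)` finite and the Weil-restriction
  identity); dually for the lower half; and the iff forms.
* §2 `exists_shaAnOverC_baseChange_padicValRat_eq_C` — the K-side valuation for ANY datum: `#Ш_an(W ⊗ K)` is a rational `q` with
  `ord₂ q = 2·M₀ − 2·v₂(c)` and `ord₂ #Ш(W ⊗ K) = ord₂ #Ш(W ⊗ K)[2^∞]` (Gross–Zagier over `K`, `w_K = 2`, odd `∏ c_ℓ`, `ord₂ I = M₀`; the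
  bookkeeping of `bsdp_two_of_card_sha_baseChange_eq_C` stopped before the comparison).
* §3 `missingUpperBoundAt_two_of_card_sha_baseChange_le_C` — **the Euler-system half of `BSD₂(W)` from Kolyvagin's upper bound at `2`
  over `K`** (`ord₂ #Ш(E_K)[2^∞] + 2·v₂(c) ≤ 2·M₀`), c floating, per datum, modulo Gross–Zagier, GZK, modularity, Milne 1972 and
  `BSD₂(Wd)`; `missingLowerBoundAt_two_of_card_sha_baseChange_ge_C` dually; `_rankOne` variants (`r_an(W) = 1`, `y_K` non-torsion).

The slice-level assemblies (the upper half on the whole slice of 23715 from a Kolyvagin-upper-bound binder, the old fkl residue (5b)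
`ShaAnTwoIntegralOnBigImageSlice` BY NAME under it, and the crux by name from the two one-sided binders) are the sequel
`…OneDoorHalvesKSlice.lean`.

References: [GrossZagier1986] V.§2; [GrossLMS1991] Thm. 1.3, §2 Conj. (2.2), §4; [McCallumLMS1991] §1, §5 Lemma 5.1;
[KolyvaginEulerSystems1990] Thm. A; [Milne1972ArithmeticAV] §1 Thm. 1; [Miller2011LMS] Def. 1.1.
-/

set_option autoImplicit false
-- the Theorems namespace of this sub repeats the summit name by design (D-0017 nested layout)
set_option linter.dupNamespace false

noncomputable section

open scoped Classical

namespace Summit.BirchSwinnertonDyer.BirchSwinnertonDyer.Theorems.RankOneAtTwoOneDoor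

open WeierstrassCurve NumberField Literature.NumberTheory.EllipticCurves Literature.NumberTheory.EllipticCurves.ModularForms
  Literature.NumberTheory.EllipticCurves.Rank1Residual
  Literature.NumberTheory.EllipticCurves.Rank1Residual.Typed
  Literature.NumberTheory.EllipticCurves.KrizLi2019
  Summit.BirchSwinnertonDyer.Rank1Residual
  Summit.BirchSwinnertonDyer.Rank1Residual.AdditivePotMult
  Summit.BirchSwinnertonDyer.Rank1Residual.F1Sign2
  Summit.BirchSwinnertonDyer.Rank1Residual.F1Sign2.TranspositionDoor
  Summit.BirchSwinnertonDyer.BirchSwinnertonDyer.Theses.ByReductionTypeAtTwo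
  Summit.BirchSwinnertonDyer.BirchSwinnertonDyer.Theorems.CMExactDescent

/-! ### §1 One-sided model-free descent on the canonical model (any prime) -/

section Descent

variable (W : WeierstrassCurve ℚ) [W.IsElliptic] [W.IsGloballyMinimal] (p : ℕ) [Fact p.Prime]
  (K : Type) [Field K] [NumberField K]
  (Wd : WeierstrassCurve ℚ) [Wd.IsElliptic] [Wd.IsGloballyMinimal]

/-- **Upper half over `K` ⟺ upper half over `ℚ`, canonical model, Milne discharged** (any `p`).  For `W/ℚ` globally minimal of
analytic rank `≤ 1`, `K` quadratic, `Wd` a globally minimal model of `W^{(d_K)}` of analytic rank `≤ 1` WITH `BSD(Wd,p)`: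
`MissingUpperBoundOverCAt (W.baseChange K) p ↔ MissingUpperBoundAt W p` — the `p`-adic BSD defect `ord_p #Ш_an − ord_p #Ш` is the same
over `K` and over `ℚ` (`AdditivePotMult.missingUpperBoundAt_iff_overC`), `Ш(E_K)` finite and the Weil-restriction identity from the
named fact `Milne1972.bsdQuotient_baseChange_quadratic_anyModel`, finiteness over `ℚ` from GZK.
[cite: Milne1972ArithmeticAV, §1 Thm. 1] [cite: Miller2011LMS, Def. 1.1] -/
theorem missingUpperBoundAt_iff_upperOverC_baseChange
    (hGZK : rank_eq_analyticRank_of_analyticRank_le_one) (hmod : hasEntireLFunction_rat)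
    (hMilneC : Milne1972.bsdQuotient_baseChange_quadratic_anyModel)
    (hr : W.analyticRank ≤ 1) (h2 : Module.finrank ℚ K = 2)
    (hWd : ∃ C : VariableChange ℚ, C • W.quadraticTwist (NumberField.discr K : ℚ) = Wd)
    (hrd : Wd.analyticRank ≤ 1) (hd : BSDp Wd p) :
    MissingUpperBoundAt W p ↔ MissingUpperBoundOverCAt (W.baseChange K) p := by
  haveI : (W.baseChange K).IsElliptic := by rw [baseChange]; infer_instance
  have hV : ∃ C : VariableChange K, C • W.baseChange K = W.baseChange K := ⟨1, one_smul _ _⟩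
  obtain ⟨-, hfinW⟩ := hGZK W hr
  obtain ⟨-, hfinD⟩ := hGZK Wd hrd
  obtain ⟨hshaK, hWR⟩ := hMilneC W K h2 Wd hWd (W.baseChange K) hV hfinW hfinD
  exact missingUpperBoundAt_iff_overC W p K Wd (W.baseChange K) hmod h2 hWd hV hfinW hfinD hshaK hWR hd

/-- **Lower half over `K` ⟺ lower half over `ℚ`, canonical model, Milne discharged** (any `p`; the `MissingLowerBoundAt` twin of
`missingUpperBoundAt_iff_upperOverC_baseChange`). [cite: Milne1972ArithmeticAV, §1 Thm. 1] [cite: Miller2011LMS, Def. 1.1] -/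
theorem missingLowerBoundAt_iff_lowerOverC_baseChange
    (hGZK : rank_eq_analyticRank_of_analyticRank_le_one) (hmod : hasEntireLFunction_rat)
    (hMilneC : Milne1972.bsdQuotient_baseChange_quadratic_anyModel)
    (hr : W.analyticRank ≤ 1) (h2 : Module.finrank ℚ K = 2)
    (hWd : ∃ C : VariableChange ℚ, C • W.quadraticTwist (NumberField.discr K : ℚ) = Wd)
    (hrd : Wd.analyticRank ≤ 1) (hd : BSDp Wd p) :
    MissingLowerBoundAt W p ↔ MissingLowerBoundOverCAt (W.baseChange K) p := by
  haveI : (W.baseChange K).IsElliptic := by rw [baseChange]; infer_instance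
  have hV : ∃ C : VariableChange K, C • W.baseChange K = W.baseChange K := ⟨1, one_smul _ _⟩
  obtain ⟨-, hfinW⟩ := hGZK W hr
  obtain ⟨-, hfinD⟩ := hGZK Wd hrd
  obtain ⟨hshaK, hWR⟩ := hMilneC W K h2 Wd hWd (W.baseChange K) hV hfinW hfinD
  exact missingLowerBoundAt_iff_overC W p K Wd (W.baseChange K) hmod h2 hWd hV hfinW hfinD hshaK hWR hd

/-- **ONE-SIDED DESCENT, upper half**: `MissingUpperBoundOverCAt (W.baseChange K) p → MissingUpperBoundAt W p` under the hypotheses of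
`missingUpperBoundAt_iff_upperOverC_baseChange` (the one-sided form of `AdditivePotMult.bsdp_of_pPartOverC_baseChange`).
[cite: Milne1972ArithmeticAV, §1 Thm. 1] -/
theorem missingUpperBoundAt_of_upperOverC_baseChange
    (hGZK : rank_eq_analyticRank_of_analyticRank_le_one) (hmod : hasEntireLFunction_rat)
    (hMilneC : Milne1972.bsdQuotient_baseChange_quadratic_anyModel)
    (hr : W.analyticRank ≤ 1) (h2 : Module.finrank ℚ K = 2)
    (hWd : ∃ C : VariableChange ℚ, C • W.quadraticTwist (NumberField.discr K : ℚ) = Wd)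
    (hrd : Wd.analyticRank ≤ 1) (hK : MissingUpperBoundOverCAt (W.baseChange K) p) (hd : BSDp Wd p) :
    MissingUpperBoundAt W p :=
  (missingUpperBoundAt_iff_upperOverC_baseChange W p K Wd hGZK hmod hMilneC hr h2 hWd hrd hd).mpr hK

/-- **ONE-SIDED DESCENT, lower half**: `MissingLowerBoundOverCAt (W.baseChange K) p → MissingLowerBoundAt W p`.
[cite: Milne1972ArithmeticAV, §1 Thm. 1] -/
theorem missingLowerBoundAt_of_lowerOverC_baseChange
    (hGZK : rank_eq_analyticRank_of_analyticRank_le_one) (hmod : hasEntireLFunction_rat)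
    (hMilneC : Milne1972.bsdQuotient_baseChange_quadratic_anyModel)
    (hr : W.analyticRank ≤ 1) (h2 : Module.finrank ℚ K = 2)
    (hWd : ∃ C : VariableChange ℚ, C • W.quadraticTwist (NumberField.discr K : ℚ) = Wd)
    (hrd : Wd.analyticRank ≤ 1) (hK : MissingLowerBoundOverCAt (W.baseChange K) p) (hd : BSDp Wd p) :
    MissingLowerBoundAt W p :=
  (missingLowerBoundAt_iff_lowerOverC_baseChange W p K Wd hGZK hmod hMilneC hr h2 hWd hrd hd).mpr hK

end Descent

/-! ### §2 The K-side valuation with the parametrisation constant floating -/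

/-- **`ord₂ #Ш_an(W ⊗ K)` for ANY datum.**  `W/ℚ` globally minimal with `ρ̄_{W,2}` onto, odd `∏ c_ℓ`; `K` imaginary quadratic with odd
`d_K ≠ −3` and the Heegner hypothesis; `Dt` ANY datum; `d₁` a conductor-`1` Kolyvagin–Heegner datum with `2^{M₀} ∥ P(1)` in `E(K[1])`;
`ord_{s=1} L(E_K,s) = 1`; Gross–Zagier at `(N_E, W, K)`, GZK, modularity.  THEN `rank E(K) = 1`, `Ш(E_K)` is finite, and
`#Ш_an(W ⊗ K) = 4 I² / (c² w_K² (∏ c_ℓ)²)` is a rational `q` with `ord₂ q = 2·M₀ − 2·v₂(c)`; moreover `ord₂ #Ш(E_K) = ord₂ #Ш(E_K)[2^∞]`.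
(The body of `bsdp_two_of_card_sha_baseChange_eq_C`, p624011, up to the comparison with the exactness binder.)
[cite: GrossZagier1986, V.§2 (pp. 310–312)] [cite: McCallumLMS1991, §5 Lemma 5.1] -/
theorem exists_shaAnOverC_baseChange_padicValRat_eq_C
    (W : WeierstrassCurve ℚ) [W.IsElliptic] [W.IsGloballyMinimal] [NeZero (W.conductorNorm ℤ)]
    (K : Type) [Field K] [NumberField K]
    (Dt : ModularParametrizationData W (W.conductorNorm ℤ)) (β : ℤ) (ι : K →+* ℂ) (d₁ : KolyvaginHeegnerData Dt β ι 1)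
    (hGZ : gross_zagier (W.conductorNorm ℤ) W K)
    (hGZK : rank_eq_analyticRank_of_analyticRank_le_one) (hmod : hasEntireLFunction_rat)
    (hρ : W.HasSurjectiveModNGaloisRep 2) (hT : Odd W.tamagawaProduct)
    (hK : IsImaginaryQuadratic K) (hodd : Odd (NumberField.discr K)) (h3 : NumberField.discr K ≠ -3)
    (hH : SatisfiesHeegnerHypothesis (W.conductorNorm ℤ) K)
    (hrK : (W.baseChange K).analyticRank = 1) {M₀ : ℕ}
    (hdiv : ∃ Q : (W.baseChange (ringClassField K ι 1)).toAffine.Point, ((2 ^ M₀ : ℕ) : ℤ) • Q = d₁.derivedPoint)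
    (hndiv : ¬ ∃ Q : (W.baseChange (ringClassField K ι 1)).toAffine.Point, ((2 ^ (M₀ + 1) : ℕ) : ℤ) • Q = d₁.derivedPoint) :
    Finite (W.baseChange K).sha ∧
      (padicValNat 2 (W.baseChange K).shaOrder : ℤ) =
        padicValNat 2 (Nat.card (AddCommGroup.primaryComponent (W.baseChange K).sha 2)) ∧
      ∃ q : ℚ, shaAnOverC (W.baseChange K) = (q : ℂ) ∧ padicValRat 2 q = 2 * (M₀ : ℤ) - 2 * padicValInt 2 Dt.c := by
  haveI : Fact (Nat.Prime 2) := ⟨Nat.prime_two⟩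
  haveI hEK : (W.baseChange K).IsElliptic := isElliptic_baseChange' W K
  have h2 : Module.finrank ℚ K = 2 := hK.1
  obtain ⟨-, hDlt⟩ := discr_emod_four_and_lt_of_odd hK hodd h3
  have hw2 : Units.torsionOrder K = 2 :=
    Literature.NumberTheory.QuadraticFields.Quadratic.torsionOrder_eq_two_of_discr_lt_neg_four h2 hDlt
  have hc0 : Dt.c ≠ 0 := Dt.maninConstant_ne_zero_holds
  -- the Heegner point `P₀ ∈ E(K)` below `P(1)`, for the datum `Dt`
  obtain ⟨P₀, Hd, hP₀, hP₀K⟩ := exists_heegnerPoint_map_eq_derivedPoint_one hK hH d₁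
  -- the exact identity over `K` (any constant)
  obtain ⟨hrkK, hShaK, hPinf, hshaCx⟩ := shaAnOverC_baseChange_eq_of_heegner W K Dt Hd ι P₀ hGZ
    hGZK hmod hK hH hP₀ hc0 hrK
  haveI hfinK : Finite (W.baseChange K).sha := hShaK
  -- `ord₂ [E(K) : ℤP₀] = M₀`
  have htor1 : ∀ (M : ℕ) (R : (W.baseChange (ringClassField K ι 1)).toAffine.Point),
      ((2 ^ M : ℕ) : ℤ) • R = 0 → R = 0 :=
    fun M R hR ↦ eq_zero_of_two_pow_smul_eq_zero_ringClassField W hK hodd hH hρ ι M R hR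
  have hdivK : ∃ Q : (W.baseChange K).toAffine.Point, ((2 ^ M₀ : ℕ) : ℤ) • Q = P₀ :=
    (X11b.Three.Koly.pDiv_one_iff_exists_zsmul_eq hK d₁ P₀ hP₀K 2 M₀ (htor1 M₀)).mp hdiv
  have hndivK : ¬ ∃ Q : (W.baseChange K).toAffine.Point, ((2 ^ (M₀ + 1) : ℕ) : ℤ) • Q = P₀ :=
    fun h ↦ hndiv ((X11b.Three.Koly.pDiv_one_iff_exists_zsmul_eq hK d₁ P₀ hP₀K 2 (M₀ + 1)
      (htor1 (M₀ + 1))).mpr h)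
  have hiv : ∀ x : (W.baseChange K).toAffine.Point, 2 • x = 0 → x = 0 :=
    fun x hx ↦ eq_zero_of_two_smul_eq_zero_baseChange W hK hodd hH hρ x hx
  haveI : Finite (AddCommGroup.torsion (W.baseChange K).toAffine.Point) :=
    WeierstrassCurve.finite_torsion_point (W := W.baseChange K)
  obtain ⟨cc, Q, hcQ, hcker⟩ :=
    X11b.RankOne.exists_coord_of_mordellWeilRank_eq_one (W.baseChange K) hrkK
  have hidx : padicValNat 2 (AddSubgroup.zmultiples P₀).index = M₀ :=
    X11b.Three.Koly.padicValNat_index_zmultiples_eq_of_divisibility (p := 2) cc Q hcQ hcker hiv P₀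
      hdivK hndivK
  -- `ord₂ #Ш_an(W ⊗ K) = 2 M₀ − 2 v₂(c)`
  set I := (AddSubgroup.zmultiples P₀).index with hI_def
  have hI0 : I ≠ 0 := fun hI ↦ by
    have hh := P2.torsionOrder_sq_mul_canonicalHeight_eq_index_sq_mul_regulator (W.baseChange K)
      hrkK P₀ hPinf
    rw [← hI_def, hI, Nat.cast_zero, zero_pow two_ne_zero, zero_mul, mul_eq_zero,
      pow_eq_zero_iff two_ne_zero, Nat.cast_eq_zero] at hh
    exact hh.elim (W.baseChange K).torsionOrder_pos_holds.ne'
      (fun h0 ↦ hPinf ((Affine.Point.canonicalHeight_eq_zero_iff_holds P₀).mp h0))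
  set q : ℚ := 4 * (I : ℚ) ^ 2 /
      ((Dt.c : ℚ) ^ 2 * (Units.torsionOrder K : ℚ) ^ 2 * ((W.tamagawaProduct : ℚ) ^ 2)) with hq_def
  have hcQ0 : (Dt.c : ℚ) ≠ 0 := by exact_mod_cast hc0
  have hcW0 : (W.tamagawaProduct : ℚ) ≠ 0 := by exact_mod_cast W.tamagawaProduct_pos_holds.ne'
  have hIQ0 : (I : ℚ) ≠ 0 := by exact_mod_cast hI0
  have hq' : q = ((I : ℚ) / ((Dt.c : ℚ) * (W.tamagawaProduct : ℚ))) ^ 2 := by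
    rw [hq_def, hw2]
    push_cast
    field_simp
    ring
  have hvc : padicValRat 2 (Dt.c : ℚ) = padicValInt 2 Dt.c := padicValRat.of_int
  have hvcW : padicValRat 2 (W.tamagawaProduct : ℚ) = 0 := by
    rw [padicValRat.of_nat, padicValNat.eq_zero_of_not_dvd hT.not_two_dvd_nat]
    rfl
  have hval : padicValRat 2 q = 2 * (M₀ : ℤ) - 2 * padicValInt 2 Dt.c := by
    rw [hq', padicValRat.pow, padicValRat.div hIQ0 (mul_ne_zero hcQ0 hcW0),
      padicValRat.mul hcQ0 hcW0, hvc, hvcW, padicValRat.of_nat, hidx]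
    push_cast
    ring
  have hshaV : (padicValNat 2 (W.baseChange K).shaOrder : ℤ) =
      padicValNat 2 (Nat.card (AddCommGroup.primaryComponent (W.baseChange K).sha 2)) := by
    rw [X11b.Three.Koly.padicValNat_shaOrder_eq (W.baseChange K) 2]
  exact ⟨hShaK, hshaV, q, hshaCx, hval⟩

/-! ### §3 The halves over `K` ⟹ the halves over `ℚ`, per datum, constant floating -/

section KSide

variable (W : WeierstrassCurve ℚ) [W.IsElliptic] [W.IsGloballyMinimal] [NeZero (W.conductorNorm ℤ)]
    (K : Type) [Field K] [NumberField K]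
    (Dt : ModularParametrizationData W (W.conductorNorm ℤ)) (β : ℤ) (ι : K →+* ℂ) (d₁ : KolyvaginHeegnerData Dt β ι 1)
    (Wd : WeierstrassCurve ℚ) [Wd.IsElliptic] [Wd.IsGloballyMinimal]
    (hGZ : gross_zagier (W.conductorNorm ℤ) W K)
    (hGZK : rank_eq_analyticRank_of_analyticRank_le_one) (hmod : hasEntireLFunction_rat)
    (hMilneC : Milne1972.bsdQuotient_baseChange_quadratic_anyModel)
    (hρ : W.HasSurjectiveModNGaloisRep 2) (hT : Odd W.tamagawaProduct)
    (hK : IsImaginaryQuadratic K) (hodd : Odd (NumberField.discr K)) (h3 : NumberField.discr K ≠ -3)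
    (hH : SatisfiesHeegnerHypothesis (W.conductorNorm ℤ) K)

include hGZ hGZK hmod hMilneC hρ hT hK hodd h3 hH

/-- **THE EULER-SYSTEM HALF OF `BSD₂(W)` FROM KOLYVAGIN'S UPPER BOUND AT `2` OVER `K`, constant floating.**  In the setting of
`exists_shaAnOverC_baseChange_padicValRat_eq_C` with `r_an(W) ≤ 1` and a globally minimal twin `Wd` of analytic rank `≤ 1` satisfying
`BSD(Wd,2)`: **`ord₂ #Ш(E_K)[2^∞] + 2·v₂(c) ≤ 2·M₀` ⟹ `ord₂ #Ш(W) ≤ ord₂ #Ш_an(W)`** (`Typed.MissingUpperBoundAt W 2`), modulo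
Gross–Zagier, GZK, modularity, Milne 1972.  (Kolyvagin's direction: `Ш(E_K)` is no larger than the Heegner index predicts.)
[cite: GrossLMS1991, Thm. 1.3 and §2 Conj. (2.2)] [cite: KolyvaginEulerSystems1990, Thm. A] [cite: Milne1972ArithmeticAV, §1 Thm. 1] -/
theorem missingUpperBoundAt_two_of_card_sha_baseChange_le_C
    (hr : W.analyticRank ≤ 1) (hrK : (W.baseChange K).analyticRank = 1) {M₀ : ℕ}
    (hdiv : ∃ Q : (W.baseChange (ringClassField K ι 1)).toAffine.Point, ((2 ^ M₀ : ℕ) : ℤ) • Q = d₁.derivedPoint)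
    (hndiv : ¬ ∃ Q : (W.baseChange (ringClassField K ι 1)).toAffine.Point, ((2 ^ (M₀ + 1) : ℕ) : ℤ) • Q = d₁.derivedPoint)
    (hshaU : (padicValNat 2 (Nat.card (AddCommGroup.primaryComponent (W.baseChange K).sha 2)) : ℤ) +
      2 * padicValInt 2 Dt.c ≤ 2 * M₀)
    (hWd : ∃ C : VariableChange ℚ, C • W.quadraticTwist (NumberField.discr K : ℚ) = Wd)
    (hrd : Wd.analyticRank ≤ 1) (hBd : BSDp Wd 2) : MissingUpperBoundAt W 2 := by
  haveI : Fact (Nat.Prime 2) := ⟨Nat.prime_two⟩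
  obtain ⟨-, hshaV, q, hq, hval⟩ := exists_shaAnOverC_baseChange_padicValRat_eq_C W K Dt β ι d₁ hGZ hGZK hmod hρ hT hK hodd h3 hH
    hrK hdiv hndiv
  have hKin : MissingUpperBoundOverCAt (W.baseChange K) 2 := ⟨q, hq, by rw [hval, hshaV]; linarith⟩
  exact missingUpperBoundAt_of_upperOverC_baseChange W 2 K Wd hGZK hmod hMilneC hr hK.1 hWd hrd hKin hBd

/-- **THE MAIN-CONJECTURE HALF OF `BSD₂(W)` FROM THE REVERSE INEQUALITY OVER `K`, constant floating**:
**`2·M₀ ≤ ord₂ #Ш(E_K)[2^∞] + 2·v₂(c)` ⟹ `ord₂ #Ш_an(W) ≤ ord₂ #Ш(W)`** (`Typed.MissingLowerBoundAt W 2`), same setting.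
[cite: GrossLMS1991, §2 Conj. (2.2)] [cite: Milne1972ArithmeticAV, §1 Thm. 1] -/
theorem missingLowerBoundAt_two_of_card_sha_baseChange_ge_C
    (hr : W.analyticRank ≤ 1) (hrK : (W.baseChange K).analyticRank = 1) {M₀ : ℕ}
    (hdiv : ∃ Q : (W.baseChange (ringClassField K ι 1)).toAffine.Point, ((2 ^ M₀ : ℕ) : ℤ) • Q = d₁.derivedPoint)
    (hndiv : ¬ ∃ Q : (W.baseChange (ringClassField K ι 1)).toAffine.Point, ((2 ^ (M₀ + 1) : ℕ) : ℤ) • Q = d₁.derivedPoint)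
    (hshaL : 2 * (M₀ : ℤ) ≤ (padicValNat 2 (Nat.card (AddCommGroup.primaryComponent (W.baseChange K).sha 2)) : ℤ) +
      2 * padicValInt 2 Dt.c)
    (hWd : ∃ C : VariableChange ℚ, C • W.quadraticTwist (NumberField.discr K : ℚ) = Wd)
    (hrd : Wd.analyticRank ≤ 1) (hBd : BSDp Wd 2) : MissingLowerBoundAt W 2 := by
  haveI : Fact (Nat.Prime 2) := ⟨Nat.prime_two⟩
  obtain ⟨-, hshaV, q, hq, hval⟩ := exists_shaAnOverC_baseChange_padicValRat_eq_C W K Dt β ι d₁ hGZ hGZK hmod hρ hT hK hodd h3 hH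
    hrK hdiv hndiv
  have hKin : MissingLowerBoundOverCAt (W.baseChange K) 2 := ⟨q, hq, by rw [hval, hshaV]; linarith⟩
  exact missingLowerBoundAt_of_lowerOverC_baseChange W 2 K Wd hGZK hmod hMilneC hr hK.1 hWd hrd hKin hBd

omit [W.IsGloballyMinimal] [Wd.IsElliptic] [Wd.IsGloballyMinimal] hGZK hMilneC hρ hT hodd h3 in
/-- The analytic ranks on the rank-ONE side: `r_an(W) = 1` and `y_K = P(1)` of infinite order give `L(W^{(d_K)},1) ≠ 0`, so the twin
`Wd` has analytic rank `0` and `ord_{s=1} L(E_K,s) = 1` (Gross–Zagier at the Heegner point below `P(1)`; the opening of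
`bsdp_two_of_card_sha_baseChange_eq_C_rankOne`). [cite: GrossZagier1986, V.§2 (p. 312)] -/
theorem analyticRank_twin_and_baseChange_of_rankOne (hr : W.analyticRank = 1) (hy : ¬ IsOfFinAddOrder d₁.derivedPoint)
    (hWd : ∃ C : VariableChange ℚ, C • W.quadraticTwist (NumberField.discr K : ℚ) = Wd) :
    Wd.analyticRank = 0 ∧ (W.baseChange K).analyticRank = 1 := by
  have h2 : Module.finrank ℚ K = 2 := hK.1
  have hD0 : (NumberField.discr K : ℚ) ≠ 0 := by exact_mod_cast NumberField.discr_ne_zero K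
  haveI hEt : (W.quadraticTwist (NumberField.discr K : ℚ)).IsElliptic := W.isElliptic_quadraticTwist hD0
  obtain ⟨P₀, Hd, hP₀, hP₀K⟩ := exists_heegnerPoint_map_eq_derivedPoint_one hK hH d₁
  have hPinf : ¬ IsOfFinAddOrder P₀ := by
    intro hfin
    apply hy
    rw [← hP₀K]
    exact (WeierstrassCurve.Affine.Point.map (W' := W) (algebraMap K (ringClassField K ι 1)).toRatAlgHom).isOfFinAddOrder hfin
  have hLK : LDerivEK W K ≠ 0 :=
    (lDerivEK_ne_zero_iff_not_isOfFinAddOrder W (W.conductorNorm ℤ) K hGZ hK hH ⟨Dt, Hd, ι, hP₀⟩).mpr hPinf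
  have hL0 : W.entireLFunction 1 = 0 := entireLFunction_one_eq_zero_of_analyticRank_eq_one hr
  have hLt : (W.quadraticTwist (NumberField.discr K : ℚ)).entireLFunction 1 ≠ 0 := by
    intro h0
    apply hLK
    rw [lDerivEK_eq_deriv_mul W K hmod hL0, h0, mul_zero]
  have hrt : (W.quadraticTwist (NumberField.discr K : ℚ)).analyticRank = 0 :=
    ((W.quadraticTwist _).analyticRank_eq_zero_iff_holds (hmod _)).mpr hLt
  have hrd : Wd.analyticRank = 0 := by
    obtain ⟨Cd, hCd⟩ := hWd
    rw [← hCd, analyticRank_smul, hrt]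
  exact ⟨hrd, (P2.analyticRank_baseChange_eq_one_iff W K hmod h2).mpr (Or.inl ⟨hr, hrt⟩)⟩

/-- **Rank-ONE member, Euler-system half**: `r_an(W) = 1`, `y_K` of infinite order, `ord₂ #Ш(E_K)[2^∞] + 2·v₂(c) ≤ 2·M₀`, `BSD(Wd,2)`
⟹ `MissingUpperBoundAt W 2`. [cite: GrossLMS1991, Thm. 1.3] [cite: Miller2011LMS, Def. 1.1] -/
theorem missingUpperBoundAt_two_of_card_sha_baseChange_le_C_rankOne
    (hr : W.analyticRank = 1) (hy : ¬ IsOfFinAddOrder d₁.derivedPoint) {M₀ : ℕ}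
    (hdiv : ∃ Q : (W.baseChange (ringClassField K ι 1)).toAffine.Point, ((2 ^ M₀ : ℕ) : ℤ) • Q = d₁.derivedPoint)
    (hndiv : ¬ ∃ Q : (W.baseChange (ringClassField K ι 1)).toAffine.Point, ((2 ^ (M₀ + 1) : ℕ) : ℤ) • Q = d₁.derivedPoint)
    (hshaU : (padicValNat 2 (Nat.card (AddCommGroup.primaryComponent (W.baseChange K).sha 2)) : ℤ) +
      2 * padicValInt 2 Dt.c ≤ 2 * M₀)
    (hWd : ∃ C : VariableChange ℚ, C • W.quadraticTwist (NumberField.discr K : ℚ) = Wd) (hBd : BSDp Wd 2) :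
    MissingUpperBoundAt W 2 := by
  obtain ⟨hrd, hrK⟩ := analyticRank_twin_and_baseChange_of_rankOne W K Dt β ι d₁ Wd hGZ hmod hK hH hr hy hWd
  exact missingUpperBoundAt_two_of_card_sha_baseChange_le_C W K Dt β ι d₁ Wd hGZ hGZK hmod hMilneC hρ hT hK hodd h3 hH hr.le hrK
    hdiv hndiv hshaU hWd (by rw [hrd]; exact zero_le_one) hBd

/-- **Rank-ONE member, main-conjecture half**: `r_an(W) = 1`, `y_K` of infinite order, `2·M₀ ≤ ord₂ #Ш(E_K)[2^∞] + 2·v₂(c)`,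
`BSD(Wd,2)` ⟹ `MissingLowerBoundAt W 2`. [cite: GrossLMS1991, §2 Conj. (2.2)] [cite: Miller2011LMS, Def. 1.1] -/
theorem missingLowerBoundAt_two_of_card_sha_baseChange_ge_C_rankOne
    (hr : W.analyticRank = 1) (hy : ¬ IsOfFinAddOrder d₁.derivedPoint) {M₀ : ℕ}
    (hdiv : ∃ Q : (W.baseChange (ringClassField K ι 1)).toAffine.Point, ((2 ^ M₀ : ℕ) : ℤ) • Q = d₁.derivedPoint)
    (hndiv : ¬ ∃ Q : (W.baseChange (ringClassField K ι 1)).toAffine.Point, ((2 ^ (M₀ + 1) : ℕ) : ℤ) • Q = d₁.derivedPoint)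
    (hshaL : 2 * (M₀ : ℤ) ≤ (padicValNat 2 (Nat.card (AddCommGroup.primaryComponent (W.baseChange K).sha 2)) : ℤ) +
      2 * padicValInt 2 Dt.c)
    (hWd : ∃ C : VariableChange ℚ, C • W.quadraticTwist (NumberField.discr K : ℚ) = Wd) (hBd : BSDp Wd 2) :
    MissingLowerBoundAt W 2 := by
  obtain ⟨hrd, hrK⟩ := analyticRank_twin_and_baseChange_of_rankOne W K Dt β ι d₁ Wd hGZ hmod hK hH hr hy hWd
  exact missingLowerBoundAt_two_of_card_sha_baseChange_ge_C W K Dt β ι d₁ Wd hGZ hGZK hmod hMilneC hρ hT hK hodd h3 hH hr.le hrK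
    hdiv hndiv hshaL hWd (by rw [hrd]; exact zero_le_one) hBd

end KSide

end Summit.BirchSwinnertonDyer.BirchSwinnertonDyer.Theorems.RankOneAtTwoOneDoor

end
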